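import Summits.HodgeConjecture.HodgeConjecture.Theorems.H413FinCoeffPureTensorOmega
import Summits.HodgeConjecture.HodgeConjecture.Theorems.H413FinAdelicEulerFactorisation
import Literature.Analysis.Complex.HolomorphicProducts
import HarnessLib

/-!
# H413 ∕ S4′(ii) (FIN): the finite Fourier coefficient of a pure tensor is non-zero, GIVEN the local rows (F3′)

Crux H413, line `F0_P4AdmissibleOccursInH1`, stub S4b (`θ_t ≠ 0`), the `hfin` row of ★
`dist_ne_zero_of_rallis_of_eigen_of_finCoeff` (`H413ThetaDistNonvanishingOfRallis`):

  `∫_{U(J₁)(𝔸_{F,f})} (∫ (ωfin(b) Φ_f)(y) conj(Ψ_f(y)) dμ(y)) · w(b) dμ_f(b) ≠ 0`.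

This file is the CONSUMER-SIDE assembly «(F2) ∘ (F3) ∘ (F3′)» of the cell's plan ([Li1992, Thm 2.1 (27) p. 184]: for
`Φ = ⊗Φ_v` the integral is the Euler product `∏_v I_v(Φ_v)` of local factors):
* (F2) ★ `finCoeff_isPureTensor_of_Omega_line` (`H413FinCoeffPureTensorOmega`): the integrand is a pure tensor over the places,
  with local factors `fl_v(g) = (ν_v(𝒪_vⁿ)⁻¹ • ⟨ω_v(g · 1_n) Φ_v, Ψ_v⟩_{ν_v}) · w(e⁻¹ ι_v g)` (Haar constant at `i₀`), and ★
  `continuous_finCoeff_of_Omega` (the integrand is continuous);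
* (F3) ★ `exists_integral_finAdelic_eq_tprod` (`H413FinAdelicEulerFactorisation`): the Euler exchange
  `∫_{U(J₁)(𝔸_f)} f dμ_f = ∏'_v ∫ f_v dν_v` (one factor rescaled by the Haar constant `κ > 0`);
* (F3′) — DISPLAYED, in the currency of the named local factors `fl` (the four rows the cell's (F3′) seat proves:
  integrability `hfl`, bounded partial `L¹` products `hB`, `Σ_v ‖I_v − 1‖ < ∞` (`hsum`), and `I_v ≠ 0` for every `v` (`hne`,
  the (F4) local bricks `Li1992/RallisLocalFactor*`));
* the conclusion by ★ `Literature.Analysis.Complex.tprod_ne_zero_of_summable_norm_sub_one` ([Conway1978, VII.5.9]) after moving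
  the two positive scalars (`μ(𝒪̂ⁿ)` and `κ`) onto the factor at `i₀` (`Summable.update`).

Main result (namespace `Summit.HodgeConjecture.HodgeConjecture.Cruxes.H413.ThetaNonvanishing`):
**`integral_finCoeff_ne_zero_of_localFactors`**.

[cite: Li1992, Thm 2.1 (27) p. 184] [cite: TateThesis1967, Thm 3.3.1] [cite: Conway1978, VII.5 Theorem 5.9]
-/

set_option autoImplicit false
set_option linter.dupNamespace false

noncomputable section

open scoped RestrictedProduct ENNReal NNReal ComplexConjugate Matrix Kronecker Classical
open MeasureTheory NumberField IsDedekindDomain Filter Function Set Topology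
open Literature.NumberTheory.Automorphic Literature.NumberTheory.Automorphic.UnitaryGroup
open Literature.NumberTheory.GelbartRogawski1991.UnitaryDualPair.LocalSplitting
open HodgeCM.PerL34 HodgeCM.PerL34.RestrictedMeasure HodgeCM.PerL34.NoSmallSubgroups

namespace Summit.HodgeConjecture.HodgeConjecture.Cruxes.H413.ThetaNonvanishing

section Line

variable (F E : Type) [Field F] [NumberField F] [Field E] [NumberField E] [Algebra F E]
  [Algebra.IsQuadraticExtension F E] (c : E ≃ₐ[F] E) (N : ℕ) {n : ℕ} (e : Fin N × Fin 1 ≃ Fin n)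
  (JV : Matrix (Fin N) (Fin N) E) (J₁ : Matrix (Fin 1) (Fin 1) E) (hJ₁ : J₁ 0 0 ≠ 0)
  {δ : E} (hcδ : c δ = -δ) (hδ : δ ≠ 0) {d : F} (hd : δ * δ = algebraMap F E d)
  (Tb : Matrix (Fin n) (Fin n) F) (hTb : Tb.IsSymm) (hJb : Matrix.reindex e e (JV ⊗ₖ J₁) = Tb.map (algebraMap F E))
  (𝓢 : FinLocalSplittings F E c n hcδ hδ hd Tb hTb hJb)
  (ωfin : finAdelic F E c 1 J₁ → ↥(SchwartzBruhat (Fin n → FiniteAdeleRing (𝓞 F) F)) →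
    ↥(SchwartzBruhat (Fin n → FiniteAdeleRing (𝓞 F) F)))
  (hωΩ : ∀ u f, ωfin u f = 𝓢.Omega (finPairEmb F E c N 1 e JV J₁ (1, u)) f)
  (w : finAdelic F E c 1 J₁ →* ℂ) (hwc : Continuous w) (T : Finset (HeightOneSpectrum (𝓞 F)))
  (hw : ∀ k ∈ RestrictedProduct.boxSubgroup (fun v => localInt E c 1 J₁ v) T, w ((finAdelicEquiv F E c 1 J₁).symm k) = 1)
  (hρT : ∀ v ∉ T, unitVec F (Fin n) v ∈
    (𝓢.omegaLoc v).fixedPoints (localInt E c n (Matrix.reindex e e (JV ⊗ₖ J₁)) v))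
  [MeasurableSpace (FiniteAdeleRing (𝓞 F) F)] [BorelSpace (FiniteAdeleRing (𝓞 F) F)]
  [∀ v : HeightOneSpectrum (𝓞 F), MeasurableSpace (v.adicCompletion F)]
  [∀ v : HeightOneSpectrum (𝓞 F), BorelSpace (v.adicCompletion F)]
  (μ : Measure (Fin n → FiniteAdeleRing (𝓞 F) F)) [μ.IsAddHaarMeasure]
  (ν : ∀ v : HeightOneSpectrum (𝓞 F), Measure (Fin n → v.adicCompletion F)) [∀ v, (ν v).IsAddHaarMeasure]
  (Φ Ψ : LocalSBFamily F (Fin n)) (hΦ : ∀ v ∉ T, Φ v = unitVec F (Fin n) v) (hΨ : ∀ v ∉ T, Ψ v = unitVec F (Fin n) v)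
  -- the (F3) data on `U(J₁)`
  [∀ v : HeightOneSpectrum (𝓞 F), MeasurableSpace (localPi E c 1 J₁ v)]
  [∀ v : HeightOneSpectrum (𝓞 F), BorelSpace (localPi E c 1 J₁ v)]
  [MeasurableSpace (finAdelic F E c 1 J₁)] [BorelSpace (finAdelic F E c 1 J₁)]
  (μf : Measure (finAdelic F E c 1 J₁)) [μf.IsHaarMeasure]
  (νW : ∀ v : HeightOneSpectrum (𝓞 F), Measure (localPi E c 1 J₁ v)) [∀ v, (νW v).IsHaarMeasure] [∀ v, SigmaFinite (νW v)]
  (S₀ : Finset (HeightOneSpectrum (𝓞 F))) {i₀ : HeightOneSpectrum (𝓞 F)} (hi₀ : i₀ ∈ S₀) (hi₀T : i₀ ∈ T)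
  (hB1 : ∀ v, v ∉ S₀ → νW v (localInt E c 1 J₁ v : Set (localPi E c 1 J₁ v)) = 1)
  -- the named local factors
  (fl : ∀ v : HeightOneSpectrum (𝓞 F), localPi E c 1 J₁ v → ℂ)
  (hfl_def : fl = fun (v : HeightOneSpectrum (𝓞 F)) (g : localPi E c 1 J₁ v) =>
    (((ν v (integralBox F (Fin n) v)).toReal⁻¹ •
      ∫ z, ((𝓢.omegaLoc v (localCenter E c n (Matrix.reindex e e (JV ⊗ₖ J₁)) J₁ hJ₁ v g) (Φ v) :
          ↥(SchwartzBruhat (Fin n → v.adicCompletion F))) : (Fin n → v.adicCompletion F) → ℂ) z *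
        conj (((Ψ v : ↥(SchwartzBruhat (Fin n → v.adicCompletion F))) :
          (Fin n → v.adicCompletion F) → ℂ) z) ∂ν v) *
      w ((finAdelicEquiv F E c 1 J₁).symm (RestrictedProduct.mulSingle (fun v => localInt E c 1 J₁ v) v g))))

include hωΩ hwc hw hρT hΦ hΨ hi₀ hi₀T hB1 hfl_def in
/-- **(FIN) from the local rows.**  Let `Φ_f = ⊗Φ_v`, `Ψ_f = ⊗Ψ_v` be pure tensors unramified off `T`, `ωfin u = Ω(1 ⊗ u)` the
finite Weil representation of the line `U(J₁)(𝔸_f)` through the big group, `w` a continuous multiplicative weight trivial on the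
box subgroup of level `T`, and `fl_v` the NAMED local factors (`hfl_def`).  IF every `fl_v` is integrable for the local Haar
measures `ν^W_v` (`vol = 1` off `S₀ ∋ i₀`), the partial products of `∫ ‖fl_v‖` over `S ⊇ S₀ ∪ T` are bounded, `Σ_v ‖I_v − 1‖ < ∞`
and every `I_v = ∫ fl_v dν^W_v ≠ 0`, THEN the finite Fourier coefficient
`∫_{U(J₁)(𝔸_f)} (∫ (ωfin(b)Φ_f) conj(Ψ_f) dμ) · w(b) dμ_f(b)` is NON-ZERO: it equals `∏'_v J_v` with `J_v = I_v` off `i₀` and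
`J_{i₀} = κ · μ(𝒪̂ⁿ) · I_{i₀}` (★ (F3) + ★ (F2)), a convergent product of non-zero factors.
[cite: Li1992, Thm 2.1 (27) p. 184] [cite: TateThesis1967, Thm 3.3.1] [cite: Conway1978, VII.5 Theorem 5.9] -/
theorem integral_finCoeff_ne_zero_of_localFactors
    (hfl : ∀ v, Integrable (fl v) (νW v))
    (hB : ∃ B : ℝ, ∀ S : Finset (HeightOneSpectrum (𝓞 F)), S₀ ⊆ S → T ⊆ S →
      ∏ v ∈ S, ∫ x, ‖fl v x‖ ∂νW v ≤ B)
    (hsum : Summable fun v => ‖(∫ x, fl v x ∂νW v) - 1‖)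
    (hne : ∀ v, ∫ x, fl v x ∂νW v ≠ 0) :
    ∫ b, (∫ y, ((ωfin b (piProdSB F (Fin n) Φ) : ↥(SchwartzBruhat (Fin n → FiniteAdeleRing (𝓞 F) F))) :
          (Fin n → FiniteAdeleRing (𝓞 F) F) → ℂ) y *
        conj (((piProdSB F (Fin n) Ψ : ↥(SchwartzBruhat (Fin n → FiniteAdeleRing (𝓞 F) F))) :
          (Fin n → FiniteAdeleRing (𝓞 F) F) → ℂ) y) ∂μ) * w b ∂μf ≠ 0 := by
  obtain ⟨κ, hκ, H⟩ := exists_integral_finAdelic_eq_tprod F E c 1 J₁ μf νW S₀ hi₀ hB1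
  -- the Haar constant of `μ` on the integral box
  have hcμ : 0 < (μ (offBox (ι := Fin n) ∅)).toReal :=
    ENNReal.toReal_pos (measure_offBox_empty_pos F (Fin n) μ).ne' (measure_offBox_empty_lt_top F (Fin n) μ).ne
  -- the updated local factors `fl' = update fl i₀ (μ(𝒪̂ⁿ) • fl i₀)`
  have hpure : ∀ S : Finset (HeightOneSpectrum (𝓞 F)), T ⊆ S →
      ∀ x : ((v : ↥S) → localPi E c 1 J₁ v) × ((v : {v // v ∉ S}) → (localInt E c 1 J₁ v : Set (localPi E c 1 J₁ v))),
        (fun b : finAdelic F E c 1 J₁ =>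
          (∫ y, ((ωfin b (piProdSB F (Fin n) Φ) : ↥(SchwartzBruhat (Fin n → FiniteAdeleRing (𝓞 F) F))) :
              (Fin n → FiniteAdeleRing (𝓞 F) F) → ℂ) y *
            conj (((piProdSB F (Fin n) Ψ : ↥(SchwartzBruhat (Fin n → FiniteAdeleRing (𝓞 F) F))) :
              (Fin n → FiniteAdeleRing (𝓞 F) F) → ℂ) y) ∂μ) * w b)
          ((finAdelicEquiv F E c 1 J₁).symm (glue (fun v => (localInt E c 1 J₁ v : Set (localPi E c 1 J₁ v))) S x)) =
        ∏ v : ↥S, Function.update fl i₀ (fun g => (μ (offBox (ι := Fin n) ∅)).toReal • fl i₀ g) v.1 (x.1 v) := by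
    intro S hS x
    subst hfl_def
    exact finCoeff_isPureTensor_of_Omega_line F E c N e JV J₁ hJ₁ hcδ hδ hd Tb hTb hJb 𝓢 ωfin hωΩ w T hw hρT μ ν Φ Ψ
      hΦ hΨ hi₀T S hS x
  have hfm : AEStronglyMeasurable (fun b : finAdelic F E c 1 J₁ =>
      (∫ y, ((ωfin b (piProdSB F (Fin n) Φ) : ↥(SchwartzBruhat (Fin n → FiniteAdeleRing (𝓞 F) F))) :
          (Fin n → FiniteAdeleRing (𝓞 F) F) → ℂ) y *
        conj (((piProdSB F (Fin n) Ψ : ↥(SchwartzBruhat (Fin n → FiniteAdeleRing (𝓞 F) F))) :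
          (Fin n → FiniteAdeleRing (𝓞 F) F) → ℂ) y) ∂μ) * w b) μf :=
    (continuous_finCoeff_of_Omega F E c N 1 e JV J₁ hcδ hδ hd Tb hTb hJb 𝓢 ωfin hωΩ w hwc μ
      (piProdSB F (Fin n) Φ) (piProdSB F (Fin n) Ψ)).aestronglyMeasurable
  have hfl' : ∀ v, Integrable (Function.update fl i₀ (fun g => (μ (offBox (ι := Fin n) ∅)).toReal • fl i₀ g) v) (νW v) := by
    intro v
    by_cases hv : v = i₀
    · subst hv
      rw [Function.update_self]
      exact (hfl v).smul ((μ (offBox (ι := Fin n) ∅)).toReal)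
    · rw [Function.update_of_ne hv]
      exact hfl v
  have hB' : ∃ B : ℝ, ∀ S : Finset (HeightOneSpectrum (𝓞 F)), S₀ ⊆ S → T ⊆ S →
      ∏ v ∈ S, ∫ x, ‖Function.update fl i₀ (fun g => (μ (offBox (ι := Fin n) ∅)).toReal • fl i₀ g) v x‖ ∂νW v ≤ B := by
    obtain ⟨B, hB⟩ := hB
    refine ⟨(μ (offBox (ι := Fin n) ∅)).toReal * B, fun S hS₀ hTS => ?_⟩
    have hi : i₀ ∈ S := hTS hi₀T
    have herase : ∏ v ∈ S.erase i₀,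
        ∫ x, ‖Function.update fl i₀ (fun g => (μ (offBox (ι := Fin n) ∅)).toReal • fl i₀ g) v x‖ ∂νW v =
          ∏ v ∈ S.erase i₀, ∫ x, ‖fl v x‖ ∂νW v :=
      Finset.prod_congr rfl fun v hv => by rw [Function.update_of_ne (Finset.ne_of_mem_erase hv)]
    rw [← Finset.mul_prod_erase S _ hi, herase, Function.update_self]
    simp only [norm_smul, Real.norm_eq_abs, abs_of_pos hcμ, integral_const_mul]
    rw [mul_assoc, Finset.mul_prod_erase S (fun v => ∫ x, ‖fl v x‖ ∂νW v) hi]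
    exact mul_le_mul_of_nonneg_left (hB S hS₀ hTS) hcμ.le
  rw [H hpure hfm hfl' hB']
  -- the factors of the Euler product
  have hJ : ∀ v, ∫ x, Function.update fl i₀ (fun g => (μ (offBox (ι := Fin n) ∅)).toReal • fl i₀ g) v x
      ∂(Function.update νW i₀ (κ • νW i₀) v) =
        Function.update (fun v => ∫ x, fl v x ∂νW v) i₀
          ((κ : ℝ) • ((μ (offBox (ι := Fin n) ∅)).toReal • ∫ x, fl i₀ x ∂νW i₀)) v := by
    intro v
    by_cases hv : v = i₀
    · subst hv
      rw [Function.update_self, Function.update_self, Function.update_self, integral_smul_nnreal_measure, integral_smul,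
        NNReal.smul_def]
    · rw [Function.update_of_ne hv, Function.update_of_ne hv, Function.update_of_ne hv]
  rw [tprod_congr hJ]
  refine Literature.Analysis.Complex.tprod_ne_zero_of_summable_norm_sub_one ?_ fun v => ?_
  · have hfun : (fun v => ‖Function.update (fun v => ∫ x, fl v x ∂νW v) i₀
        ((κ : ℝ) • ((μ (offBox (ι := Fin n) ∅)).toReal • ∫ x, fl i₀ x ∂νW i₀)) v - 1‖) =
        Function.update (fun v => ‖(∫ x, fl v x ∂νW v) - 1‖) i₀
          ‖(κ : ℝ) • ((μ (offBox (ι := Fin n) ∅)).toReal • ∫ x, fl i₀ x ∂νW i₀) - 1‖ := by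
      funext v
      by_cases hv : v = i₀
      · subst hv; rw [Function.update_self, Function.update_self]
      · rw [Function.update_of_ne hv, Function.update_of_ne hv]
    rw [hfun]
    exact hsum.update i₀ _
  · by_cases hv : v = i₀
    · subst hv
      rw [Function.update_self]
      exact smul_ne_zero (NNReal.coe_pos.2 hκ).ne' (smul_ne_zero hcμ.ne' (hne v))
    · rw [Function.update_of_ne hv]
      exact hne v

end Line

end Summit.HodgeConjecture.HodgeConjecture.Cruxes.H413.ThetaNonvanishing

end
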